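import Summits.ValiantsHypothesis.ValiantsHypothesis.Theorems.GrenetZeonDualUnipotentThreeHalvesHeavyTopInvariantFlag
import Summits.ValiantsHypothesis.ValiantsHypothesis.Theorems.GrenetZeonDualUnipotentThreeHalvesHeavyTopTorusInitial
import Literature.LinearAlgebra.Matrix.GerstenhaberNilpotentSubspaceEquality

/-!
# `GrenetZeon.DualUnipotentThreeHalves` (stmt-ValiantsHypothesis-24318), R2 heavy-top instrument — COROLLARY II port, step (L1):
# PLUMBING — the conjugated space and the diagonal-block images as submodules (existence form, no definitions)

The classification by the composition-chain route (crux note `CENSUS-THMC-UNIFORM-eng1g5.md` §8.5) conjugates `V` by the unit of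
✓ `HeavyTopCompositionBlocks.exists_block_conj` and reads off the diagonal-block images `W_t ≤ M_{s_t}(ℂ)`; ★ `levels_of_deficiency_le_one`
(…CodimOneLevels) takes these as data with three properties (blocks land in `W_t`; `W_t` nilpotent; `W_t` irreducible).  This file produces them:

* `exists_conj_submodule` — for a unit `P`: a submodule `V'` (namely `P V P⁻¹`) with `dim V' = dim V`, `A ∈ V ↔ P A P⁻¹ ∈ V'`, every member of `V'`
  of the form `P A P⁻¹` (`A ∈ V`), nilpotent when `V` is;
* `exists_block_image` — for a block upper-triangular nilpotent `V'` (`A i j = 0` for `lvl i < lvl j`), a level `t` and a re-indexing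
  `e : {lvl = t} ≃ Fin s`: a submodule `W ≤ M_s(ℂ)` containing every re-indexed `t`-block of `V'`, consisting of such blocks, NILPOTENT
  (✓ `HeavyTopInvariantFlag.isNilpotent_reindex_toBlock`), and IRREDUCIBLE as soon as the blocks act irreducibly (the clause of `exists_block_conj`).

Honest framing: plumbing; nothing here proves or refutes `HeavyTopLaw`, 24318, S3b or 8062; `VP ≠ VNP` is NOT proved.  No definitions.
[folklore; cell val-heavytop-census, eng-1 g5]
-/

noncomputable section

-- single-conjunct layout: Sub = Summit, duplicated namespace component intended
set_option linter.dupNamespace false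

namespace Summit.ValiantsHypothesis.ValiantsHypothesis.Theorems.GrenetZeon.HeavyTopCodimOnePlumbing

open Matrix
open Summit.ValiantsHypothesis.ValiantsHypothesis.Theorems.GrenetZeon.HeavyTopInvariantFlag (isNilpotent_reindex_toBlock)
open Summit.ValiantsHypothesis.ValiantsHypothesis.Theorems.GrenetZeon.HeavyTopTorusInitial (pow_eq_zero_of_isNilpotent)
open Literature.LinearAlgebra.Matrix.GerstenhaberNilpotentSubspace (conjEquiv isNilpotent_conjEquiv_iff)

/-- **The conjugated space `P V P⁻¹` as a submodule** (existence form): same dimension, membership by conjugation, members are conjugates,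
nilpotent when `V` is. [folklore] -/
theorem exists_conj_submodule {m : ℕ} (V : Submodule ℂ (Matrix (Fin m) (Fin m) ℂ)) (P : Matrix (Fin m) (Fin m) ℂ) (hP : IsUnit P) :
    ∃ V' : Submodule ℂ (Matrix (Fin m) (Fin m) ℂ),
      Module.finrank ℂ V' = Module.finrank ℂ V ∧
      (∀ A, A ∈ V ↔ P * A * P⁻¹ ∈ V') ∧
      (∀ B ∈ V', ∃ A ∈ V, P * A * P⁻¹ = B) ∧
      ((∀ A ∈ V, IsNilpotent A) → ∀ B ∈ V', IsNilpotent B) := by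
  have hPdet : IsUnit P.det := (Matrix.isUnit_iff_isUnit_det P).1 hP
  refine ⟨V.map (conjEquiv P hPdet).toLinearMap, LinearEquiv.finrank_map_eq _ _, fun A => ?_, fun B hB => ?_, fun hV B hB => ?_⟩
  · constructor
    · intro hA
      exact Submodule.mem_map.2 ⟨A, hA, rfl⟩
    · intro hA
      obtain ⟨A', hA', hAA'⟩ := Submodule.mem_map.1 hA
      have : A' = A := (conjEquiv P hPdet).injective hAA'
      exact this ▸ hA'
  · obtain ⟨A, hA, rfl⟩ := Submodule.mem_map.1 hB
    exact ⟨A, hA, rfl⟩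
  · obtain ⟨A, hA, rfl⟩ := Submodule.mem_map.1 hB
    exact (isNilpotent_conjEquiv_iff P hPdet A).2 (hV A hA)

/-- **The diagonal-block image `W_t` as a submodule** (existence form): contains the re-indexed `t`-blocks of `V'`, consists of them, is nilpotent,
and is irreducible whenever the blocks act irreducibly. [folklore] -/
theorem exists_block_image {m s : ℕ} (lvl : Fin m → ℕ) (V' : Submodule ℂ (Matrix (Fin m) (Fin m) ℂ)) (hnil : ∀ A ∈ V', IsNilpotent A)
    (hblock : ∀ A ∈ V', ∀ i j, lvl i < lvl j → A i j = 0) (t : ℕ) (e : {i : Fin m // lvl i = t} ≃ Fin s) :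
    ∃ W : Submodule ℂ (Matrix (Fin s) (Fin s) ℂ),
      (∀ A ∈ V', Matrix.reindex e e (A.toBlock (fun i => lvl i = t) (fun i => lvl i = t)) ∈ W) ∧
      (∀ X ∈ W, ∃ A ∈ V', Matrix.reindex e e (A.toBlock (fun i => lvl i = t) (fun i => lvl i = t)) = X) ∧
      (∀ X ∈ W, IsNilpotent X) ∧
      ((∀ U : Submodule ℂ (Fin s → ℂ),
          (∀ A ∈ V', ∀ x ∈ U, Matrix.reindex e e (A.toBlock (fun i => lvl i = t) (fun i => lvl i = t)) *ᵥ x ∈ U) → U = ⊥ ∨ U = ⊤) →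
        ∀ U : Submodule ℂ (Fin s → ℂ), (∀ X ∈ W, ∀ x ∈ U, X *ᵥ x ∈ U) → U = ⊥ ∨ U = ⊤) := by
  -- the block map as a linear map
  let β : Matrix (Fin m) (Fin m) ℂ →ₗ[ℂ] Matrix (Fin s) (Fin s) ℂ :=
    { toFun := fun A => Matrix.reindex e e (A.toBlock (fun i => lvl i = t) (fun i => lvl i = t))
      map_add' := fun A B => by ext a b; rfl
      map_smul' := fun c A => by ext a b; rfl }
  refine ⟨V'.map β, fun A hA => Submodule.mem_map.2 ⟨A, hA, rfl⟩, fun X hX => ?_, fun X hX => ?_, fun hirr U hU => ?_⟩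
  · obtain ⟨A, hA, rfl⟩ := Submodule.mem_map.1 hX
    exact ⟨A, hA, rfl⟩
  · obtain ⟨A, hA, rfl⟩ := Submodule.mem_map.1 hX
    have h := isNilpotent_reindex_toBlock lvl A (hblock A hA) (pow_eq_zero_of_isNilpotent A (hnil A hA)) t e
    exact h
  · exact hirr U fun A hA x hx => hU _ (Submodule.mem_map.2 ⟨A, hA, rfl⟩) x hx

end Summit.ValiantsHypothesis.ValiantsHypothesis.Theorems.GrenetZeon.HeavyTopCodimOnePlumbing

end
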